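import Summits.CriticalPhenomena.PercolationContinuityZ3.Theorems.PercNearOneGluingNoHeavyLowerTailForestRayleighRelabel
import HarnessLib

/-!
# Weighted forest negative correlation — relabelling II: the Rayleigh property of an edge system under injective vertex maps and sub-systems

Notation as in `…ForestRayleighTools`; "`T` has the Rayleigh property" = `(R)(D;K;e,f)` for all activities
`w ≥ 0` and every instance inside `T` (written out). This file records the two closure rules used to
move finite computations around:

* `rayleigh_mono`: a sub-system of a Rayleigh system is Rayleigh (instances inside `T' ⊆ T` are
  instances inside `T`);
* `rayleigh_of_image`: if `T ⊆ Sym2 U` is loop-free and Rayleigh and `φ : U → V` is injective then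
  `Φ T ⊆ Sym2 V` (`Φ = Sym2.map φ`) is Rayleigh — pull the instance back along `Φ`, apply `(R)` with the
  activities `w ∘ Φ`, push forward with `lsm_image`.

Theorems only; no definitions, no `sorry`.
-/

open Finset SimpleGraph
open scoped Classical

namespace Summit.CriticalPhenomena.PercolationContinuityZ3.Theorems.ForestRayleigh

variable {U V : Type*} [Fintype U] [DecidableEq U] [Fintype V] [DecidableEq V]

omit [Fintype U] [DecidableEq U] [Fintype V] in
/-- **Sub-systems of Rayleigh systems are Rayleigh.** [trivial] -/
theorem rayleigh_mono (T T' : Finset (Sym2 V)) (hTT : T' ⊆ T)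
    (hR : ∀ (w : Sym2 V → ℝ), (∀ x, 0 ≤ w x) → ∀ (D K : Finset (Sym2 V)) (e f : Sym2 V),
      D ∪ insert e (insert f K) ⊆ T → Disjoint D K → e ∉ D → e ∉ K → f ∉ D →
      f ∉ K → e ≠ f →
      (∑ G ∈ D.powerset.filter (fun G =>
        (fromEdgeSet ((G ∪ (insert e (insert f (K))) : Finset (Sym2 V)) : Set (Sym2 V))).IsAcyclic), ∏ x ∈ G, w x) *
        (∑ G ∈ D.powerset.filter (fun G =>
        (fromEdgeSet ((G ∪ (K) : Finset (Sym2 V)) : Set (Sym2 V))).IsAcyclic), ∏ x ∈ G, w x) ≤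
      (∑ G ∈ D.powerset.filter (fun G =>
        (fromEdgeSet ((G ∪ (insert e (K)) : Finset (Sym2 V)) : Set (Sym2 V))).IsAcyclic), ∏ x ∈ G, w x) *
        (∑ G ∈ D.powerset.filter (fun G =>
        (fromEdgeSet ((G ∪ (insert f (K)) : Finset (Sym2 V)) : Set (Sym2 V))).IsAcyclic), ∏ x ∈ G, w x))
    :
    ∀ (w : Sym2 V → ℝ), (∀ x, 0 ≤ w x) → ∀ (D K : Finset (Sym2 V)) (e f : Sym2 V),
      D ∪ insert e (insert f K) ⊆ T' → Disjoint D K → e ∉ D → e ∉ K → f ∉ D →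
      f ∉ K → e ≠ f →
      (∑ G ∈ D.powerset.filter (fun G =>
        (fromEdgeSet ((G ∪ (insert e (insert f (K))) : Finset (Sym2 V)) : Set (Sym2 V))).IsAcyclic), ∏ x ∈ G, w x) *
        (∑ G ∈ D.powerset.filter (fun G =>
        (fromEdgeSet ((G ∪ (K) : Finset (Sym2 V)) : Set (Sym2 V))).IsAcyclic), ∏ x ∈ G, w x) ≤
      (∑ G ∈ D.powerset.filter (fun G =>
        (fromEdgeSet ((G ∪ (insert e (K)) : Finset (Sym2 V)) : Set (Sym2 V))).IsAcyclic), ∏ x ∈ G, w x) *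
        (∑ G ∈ D.powerset.filter (fun G =>
        (fromEdgeSet ((G ∪ (insert f (K)) : Finset (Sym2 V)) : Set (Sym2 V))).IsAcyclic), ∏ x ∈ G, w x) :=
  fun w hw D K e f hsub hDK heD heK hfD hfK hef =>
    hR w hw D K e f (hsub.trans hTT) hDK heD heK hfD hfK hef

/-- **The Rayleigh property is transported by injective relabellings.** For loop-free `T ⊆ Sym2 U`
with the Rayleigh property and `φ : U → V` injective, `T.image (Sym2.map φ)` has the Rayleigh
property. [elementary; `lsm_image`] -/
theorem rayleigh_of_image (φ : U → V) (hφ : Function.Injective φ) (T : Finset (Sym2 U))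
    (hT : ∀ z ∈ T, ¬z.IsDiag)
    (hR : ∀ (w : Sym2 U → ℝ), (∀ x, 0 ≤ w x) → ∀ (D K : Finset (Sym2 U)) (e f : Sym2 U),
      D ∪ insert e (insert f K) ⊆ T → Disjoint D K → e ∉ D → e ∉ K → f ∉ D →
      f ∉ K → e ≠ f →
      (∑ G ∈ D.powerset.filter (fun G =>
        (fromEdgeSet ((G ∪ (insert e (insert f (K))) : Finset (Sym2 U)) : Set (Sym2 U))).IsAcyclic), ∏ x ∈ G, w x) *
        (∑ G ∈ D.powerset.filter (fun G =>
        (fromEdgeSet ((G ∪ (K) : Finset (Sym2 U)) : Set (Sym2 U))).IsAcyclic), ∏ x ∈ G, w x) ≤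
      (∑ G ∈ D.powerset.filter (fun G =>
        (fromEdgeSet ((G ∪ (insert e (K)) : Finset (Sym2 U)) : Set (Sym2 U))).IsAcyclic), ∏ x ∈ G, w x) *
        (∑ G ∈ D.powerset.filter (fun G =>
        (fromEdgeSet ((G ∪ (insert f (K)) : Finset (Sym2 U)) : Set (Sym2 U))).IsAcyclic), ∏ x ∈ G, w x))
    :
    ∀ (w : Sym2 V → ℝ), (∀ x, 0 ≤ w x) → ∀ (D K : Finset (Sym2 V)) (e f : Sym2 V),
      D ∪ insert e (insert f K) ⊆ (T.image (Sym2.map φ)) → Disjoint D K → e ∉ D → e ∉ K → f ∉ D →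
      f ∉ K → e ≠ f →
      (∑ G ∈ D.powerset.filter (fun G =>
        (fromEdgeSet ((G ∪ (insert e (insert f (K))) : Finset (Sym2 V)) : Set (Sym2 V))).IsAcyclic), ∏ x ∈ G, w x) *
        (∑ G ∈ D.powerset.filter (fun G =>
        (fromEdgeSet ((G ∪ (K) : Finset (Sym2 V)) : Set (Sym2 V))).IsAcyclic), ∏ x ∈ G, w x) ≤
      (∑ G ∈ D.powerset.filter (fun G =>
        (fromEdgeSet ((G ∪ (insert e (K)) : Finset (Sym2 V)) : Set (Sym2 V))).IsAcyclic), ∏ x ∈ G, w x) *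
        (∑ G ∈ D.powerset.filter (fun G =>
        (fromEdgeSet ((G ∪ (insert f (K)) : Finset (Sym2 V)) : Set (Sym2 V))).IsAcyclic), ∏ x ∈ G, w x) := by
  intro w hw D K e f hsub hDK heD heK hfD hfK hef
  have hDsub : D ⊆ T.image (Sym2.map φ) := fun z hz => hsub (Finset.mem_union_left _ hz)
  have hKsub : K ⊆ T.image (Sym2.map φ) := fun z hz =>
    hsub (Finset.mem_union_right _ (Finset.mem_insert_of_mem (Finset.mem_insert_of_mem hz)))
  have heT : e ∈ T.image (Sym2.map φ) :=
    hsub (Finset.mem_union_right _ (Finset.mem_insert_self _ _))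
  have hfT : f ∈ T.image (Sym2.map φ) :=
    hsub (Finset.mem_union_right _ (Finset.mem_insert_of_mem (Finset.mem_insert_self _ _)))
  obtain ⟨D₀, hD₀, rfl⟩ := Finset.subset_image_iff.1 hDsub
  obtain ⟨K₀, hK₀, rfl⟩ := Finset.subset_image_iff.1 hKsub
  obtain ⟨e₀, he₀, rfl⟩ := Finset.mem_image.1 heT
  obtain ⟨f₀, hf₀, rfl⟩ := Finset.mem_image.1 hfT
  have heD₀ : e₀ ∉ D₀ := fun h => heD (Finset.mem_image_of_mem _ h)
  have heK₀ : e₀ ∉ K₀ := fun h => heK (Finset.mem_image_of_mem _ h)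
  have hfD₀ : f₀ ∉ D₀ := fun h => hfD (Finset.mem_image_of_mem _ h)
  have hfK₀ : f₀ ∉ K₀ := fun h => hfK (Finset.mem_image_of_mem _ h)
  have hef₀ : e₀ ≠ f₀ := fun h => hef (h ▸ rfl)
  have hDK₀ : Disjoint D₀ K₀ := Finset.disjoint_left.2 fun z h₁ h₂ =>
    Finset.disjoint_left.1 hDK (Finset.mem_image_of_mem _ h₁) (Finset.mem_image_of_mem _ h₂)
  have hsub₀ : D₀ ∪ insert e₀ (insert f₀ K₀) ⊆ T :=
    Finset.union_subset hD₀ (Finset.insert_subset he₀ (Finset.insert_subset hf₀ hK₀))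
  refine lsm_image φ hφ w D₀ K₀ e₀ f₀ (fun z hz => hT z (hsub₀ hz)) ?_
  exact hR (fun x => w (Sym2.map φ x)) (fun x => hw _) D₀ K₀ e₀ f₀ hsub₀ hDK₀ heD₀ heK₀ hfD₀ hfK₀ hef₀

end Summit.CriticalPhenomena.PercolationContinuityZ3.Theorems.ForestRayleigh
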